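/-
Copyright (c) 2026. Released under the Apache 2.0 license.
-/
import Literature.NumberTheory.EllipticCurves.ManinConstantClassCertificateTwistGamma0Proofs
import HarnessLib

/-!
# A sixth source of `ClassAbsManinConstantEqOne W`: at each square prime, Edixhoven 1991 Thm. 3
# (`p > 7`), OR Kodaira type `Iₙ*` at an odd prime (Tate's algorithm alone), OR a displayed twist
# witness — the named predicate of the Kodaira-keyed `Γ₀` twist road

This small file NAMES the hypothesis of the kernel theorem
`classAbsManinConstantEqOne_of_forall_sq_prime_edixhoven_or_kodairaIstar_or_twist_gamma0`
(`ManinConstantClassCertificateTwistGamma0Proofs.lean`) as a class predicate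
`IsEdixhovenKodairaTwistCovered W`, in the format of the tree's earlier class certificates
(`IsMazurCesnaviciusCovered`, `IsEdixhovenCesnaviciusCovered`, `IsEdixhovenCesnaviciusTwistCovered`):
at every prime `p` with `p² ∣ N(W')`, for every globally minimal member `W'` of the isogeny class
of `W`, ONE of

* `7 < p` and `EdixhovenNonexceptionalAt W' p` (Edixhoven 1991 Thm. 3: Kodaira type at `p` not
  `II`, `III`, `IV`, or not potentially good ordinary) — served by the named facts
  `edixhoven_not_dvd_maninConstant_of_kodairaSymbol_ne` / `…_of_not_potentiallyGoodOrdinary`;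
* `p ≠ 2` and the Kodaira symbol of `W'` at `p` is `Iₙ*` for some `n ≥ 0` — served by the THEOREM
  `not_dvd_maninConstant_of_kodairaSymbolAt_eq_Istar` (`ManinConstantQuadraticTwistIstarProofs.lean`:
  the twist `W' ⊗ χ_{p*}` is good (`n = 0`) or multiplicative (`n ≥ 1`) at `p`, Silverman *ATAEC*
  IV.11.1 table p. 368; then Stevens' twisting argument on `Γ₀` and Mazur 1978 / Česnavičius 2018
  at the prime `p ∥ N(𝒜')`); no witness curve, no torsion clause, every odd `p`;
* `TwistSemistableWitnessAt W' p` (the displayed witness of `ManinConstantClassCertificateTwist.lean`)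
  — served by `not_dvd_maninConstant_of_twistSemistableWitnessAt_gamma0`.

`IsEdixhovenCesnaviciusTwistCovered W → IsEdixhovenKodairaTwistCovered W`
(`IsEdixhovenCesnaviciusTwistCovered.kodairaTwistCovered`), so every class certified under the
earlier predicate is certified under this one, by the same six named inputs `hM hAU hC hEA hEB hnf`.
Definitions and their unfolding lemmas only; the constructor is one line from the `Γ₀` file.

## References
* [EdixhovenManin1991] B. Edixhoven, Progr. Math. 89 (1991), §1 and Thm. 3.
* [Cesnavicius2018] K. Česnavičius, Compositio Math. 154 (2018), Thm. 1.2.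
* [Stevens1989] G. Stevens, Invent. Math. 98 (1989), Lemmas (5.2), (5.4).
* [SilvermanATAEC1994] J. H. Silverman, *ATAEC*, IV.9 Table 4.1 and IV.11.1 table p. 368.
* [Mazur1978] B. Mazur, Invent. Math. 44 (1978), Cor. 4.1.
-/

noncomputable section

open scoped MatrixGroups ModularForm

open CongruenceSubgroup WeierstrassCurve

namespace Literature.NumberTheory.EllipticCurves.ModularForms

/-- **The "Edixhoven–Kodaira–twist covered" classes**: at every square prime `p` of the conductor of
every globally minimal member `W'` of the class of `W`, either `p > 7` and `W'` is outside
Edixhoven's printed exception (`EdixhovenNonexceptionalAt`), or `p` is odd and the Kodaira symbol of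
`W'` at `p` (Tate's algorithm at the place `(p)` of `ℤ`, `WeierstrassCurve.kodairaSymbolAt`) is `Iₙ*`
for some `n ≥ 0`, or a twist witness `TwistSemistableWitnessAt W' p` is displayed. A predicate;
nothing asserted. [cite: EdixhovenManin1991, §1 and Thm. 3] [cite: Cesnavicius2018, Thm. 1.2]
[cite: SilvermanATAEC1994, IV.11.1 table p. 368] -/
def IsEdixhovenKodairaTwistCovered (W : WeierstrassCurve ℚ) : Prop :=
  ∀ (W' : WeierstrassCurve ℚ) [W'.IsElliptic] [W'.IsGloballyMinimal], IsIsogenous W W' →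
    ∀ (p : ℕ) (hp : p.Prime), p ^ 2 ∣ W'.conductorNorm ℤ →
      (7 < p ∧ EdixhovenNonexceptionalAt W' p hp) ∨
      (p ≠ 2 ∧ ∃ n : ℕ,
        W'.kodairaSymbolAt ((Rat.HeightOneSpectrum.primesEquiv (R := ℤ)).symm ⟨p, hp⟩) = .Istar n) ∨
      @TwistSemistableWitnessAt W' p ⟨hp⟩

/-- Unfolding of `IsEdixhovenKodairaTwistCovered` (by `Iff.rfl`).
[cite: EdixhovenManin1991, §1 and Thm. 3] -/
theorem isEdixhovenKodairaTwistCovered_iff (W : WeierstrassCurve ℚ) :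
    IsEdixhovenKodairaTwistCovered W ↔
      ∀ (W' : WeierstrassCurve ℚ) [W'.IsElliptic] [W'.IsGloballyMinimal], IsIsogenous W W' →
        ∀ (p : ℕ) (hp : p.Prime), p ^ 2 ∣ W'.conductorNorm ℤ →
          (7 < p ∧ EdixhovenNonexceptionalAt W' p hp) ∨
          (p ≠ 2 ∧ ∃ n : ℕ,
            W'.kodairaSymbolAt ((Rat.HeightOneSpectrum.primesEquiv (R := ℤ)).symm ⟨p, hp⟩) =
              .Istar n) ∨
          @TwistSemistableWitnessAt W' p ⟨hp⟩ :=
  Iff.rfl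

/-- An Edixhoven–Česnavičius–twist covered class (`ManinConstantClassCertificateTwist.lean`) is
Edixhoven–Kodaira–twist covered (first and third disjuncts). [cite: EdixhovenManin1991, Thm. 3] -/
theorem IsEdixhovenCesnaviciusTwistCovered.kodairaTwistCovered {W : WeierstrassCurve ℚ}
    (h : IsEdixhovenCesnaviciusTwistCovered W) : IsEdixhovenKodairaTwistCovered W :=
  fun W' _ _ hiso p hp hsq ↦ (h W' hiso p hp hsq).elim Or.inl fun htw ↦ Or.inr (Or.inr htw)

/-- A class all of whose minimal members have, at each square prime, an odd prime with Kodaira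
type `Iₙ*` is Edixhoven–Kodaira–twist covered (middle disjunct everywhere).
[cite: SilvermanATAEC1994, IV.11.1 table p. 368] -/
theorem isEdixhovenKodairaTwistCovered_of_forall_kodairaIstar {W : WeierstrassCurve ℚ}
    (h : ∀ (W' : WeierstrassCurve ℚ) [W'.IsElliptic] [W'.IsGloballyMinimal], IsIsogenous W W' →
      ∀ (p : ℕ) (hp : p.Prime), p ^ 2 ∣ W'.conductorNorm ℤ →
        p ≠ 2 ∧ ∃ n : ℕ,
          W'.kodairaSymbolAt ((Rat.HeightOneSpectrum.primesEquiv (R := ℤ)).symm ⟨p, hp⟩) = .Istar n) :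
    IsEdixhovenKodairaTwistCovered W :=
  fun W' _ _ hiso p hp hsq ↦ Or.inr (Or.inl (h W' hiso p hp hsq))

/-- **The class certificate BY NAME — `Γ₀` road, binders `hM hAU hC hEA hEB hnf`**:
`IsEdixhovenKodairaTwistCovered W → ClassAbsManinConstantEqOne W`; the kernel theorem
`classAbsManinConstantEqOne_of_forall_sq_prime_edixhoven_or_kodairaIstar_or_twist_gamma0` under its
named hypothesis. [cite: EdixhovenManin1991, §1 and Thm. 3] [cite: Cesnavicius2018, Thm. 1.2]
[cite: Stevens1989, Lemmas (5.2), (5.4)] [cite: Mazur1978, Cor. 4.1] -/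
theorem classAbsManinConstantEqOne_of_isEdixhovenKodairaTwistCovered
    (hM : mazur_not_dvd_maninConstant_of_odd)
    (hAU : abbesUllmo_not_dvd_maninConstant_of_not_dvd_level)
    (hC : cesnavicius_not_two_dvd_maninConstant_of_two_dvd_level)
    (hEA : edixhoven_not_dvd_maninConstant_of_not_potentiallyGoodOrdinary)
    (hEB : edixhoven_not_dvd_maninConstant_of_kodairaSymbol_ne)
    (hnf : exists_isNewformOf)
    (W : WeierstrassCurve ℚ) (hcov : IsEdixhovenKodairaTwistCovered W) :
    ClassAbsManinConstantEqOne W :=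
  classAbsManinConstantEqOne_of_forall_sq_prime_edixhoven_or_kodairaIstar_or_twist_gamma0 hM hAU hC
    hEA hEB hnf W hcov

/-- The binder form carried by consumers: for an Edixhoven–Kodaira–twist covered class, `p ∤ c` for
EVERY prime `p` and every lattice-optimal `X₀`-datum of every globally minimal member, modulo
`hM hAU hC hEA hEB hnf`. [cite: EdixhovenManin1991, §1 and Thm. 3] [cite: Cesnavicius2018, Thm. 1.2] -/
theorem not_dvd_maninConstant_of_isEdixhovenKodairaTwistCovered
    (hM : mazur_not_dvd_maninConstant_of_odd)
    (hAU : abbesUllmo_not_dvd_maninConstant_of_not_dvd_level)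
    (hC : cesnavicius_not_two_dvd_maninConstant_of_two_dvd_level)
    (hEA : edixhoven_not_dvd_maninConstant_of_not_potentiallyGoodOrdinary)
    (hEB : edixhoven_not_dvd_maninConstant_of_kodairaSymbol_ne)
    (hnf : exists_isNewformOf)
    {W : WeierstrassCurve ℚ} (hcov : IsEdixhovenKodairaTwistCovered W)
    (W' : WeierstrassCurve ℚ) [W'.IsElliptic] [W'.IsGloballyMinimal] {N' : ℕ} [NeZero N']
    (D' : ModularParametrizationData W' N') (hiso : IsIsogenous W W')
    (hopt : ∀ z ∈ D'.L.lattice, ∃ w ∈ periodLattice D'.f, z = D'.c * w)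
    (p : ℕ) (hp : p.Prime) : ¬ (p : ℤ) ∣ D'.maninConstant :=
  (classAbsManinConstantEqOne_of_isEdixhovenKodairaTwistCovered hM hAU hC hEA hEB hnf W
    hcov).not_dvd_maninConstant D' hiso hopt hp

end Literature.NumberTheory.EllipticCurves.ModularForms

end
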